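import Literature.Topology.FourManifolds.SPC4HandlesTwoLeaves
import Literature.Topology.FourManifolds.SPC4HandlesThmAGenusZero
import Literature.Topology.FourManifolds.SPC4HandlesImpliesCerf
import HarnessLib

/-!
# Laudenbach–Poénaru's extension theorem after Cerf: the positive-genus residue

Topic `Literature/Topology/FourManifolds`; fact seat
`provefact-Literature.Topology.FourManifolds.exists-deb81d384f` of the named fact
`Literature.Topology.FourManifolds.exists_diffeomorph_comp_incl_eq` (**spc4.S24 (c)**,
`SPC4Handles.lean`: every self-diffeomorphism of the boundary `#k S¹ × S²` of a compact connected
orientable smooth `4`-dimensional `1`-handlebody `V ≅ ♮k S¹ × B³` extends over `V`;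
Laudenbach–Poénaru, Bull. SMF 100 (1972), Thm. A and its proof, §2, pp. 341–342, in the extension
form quoted by Kirby (1989), Ch. I §2, p. 8).  Everything here is **proved**; no definition and no
named fact is introduced.

State of the proof DAG in the tree.  The fact follows from two leaves
(`exists_diffeomorph_comp_incl_eq_of_two_leaves`, `SPC4HandlesTwoLeaves.lean`): the realisation
REALISE of the generators of `Aut F_p` on one model per `p` (Lemma 2, pp. 339–340; equivalently
h₁, `exists_diffeomorph_comp_incl_eq_of_lemma2_of_thmA_zero`) and THMAᴹ in universe `0`
(`exists_oneHandlebody_laudenbachPoenaru_diffeoExtends_of_isOrientationPreserving`: on one model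
per `p`, every orientation-preserving based `π₁`-trivial self-diffeomorphism of the boundary
extends).  Conversely the fact contains THMAᴹ
(`exists_oneHandlebody_laudenbachPoenaru_diffeoExtends_of_isOrientationPreserving_of_exists_diffeomorph_comp_incl_eq_zero`)
and, at `p = 0`, it *is* Cerf's `Γ₄ = 0` in extension form
(`cerf_diffeomorph_sphere_three_extends_ball_of_exists_diffeomorph_comp_incl_eq`,
`SPC4HandlesImpliesCerf.lean`; `cerf_iff_diffeoExtends_genusZero`, `SPC4HandlesThmAGenusZero.lean`),
the tree's named fact `Literature.Topology.FourManifolds.cerf_diffeomorph_sphere_three_extends_ball`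
(`CerfGammaFourProofs.lean`; Cerf, LNM 53 (1968), Ch. I §1, Théorème 1 with Corollaire 1), itself
reduced in the tree to Cerf's statement (2), `π₀(Diff(D³; S²)) = 0`
(`cerf_pi0DiffDisc_relBoundary_three`, `CerfPropositionFour.lean`).

This file isolates what is left of THMAᴹ **once `Γ₄ = 0` is granted**: its positive-genus
slice, i.e. Laudenbach–Poénaru's argument proper for `p ≥ 1` (p. 342: Lemma 3 — a
`π₁`-trivial orientation-preserving homeomorphism of `#p S¹ × S²` is `π₂`-trivial, p. 340 — then
Laudenbach's isotopy theorem for homotopic systems of `2`-spheres in `#p S¹ × S²`, Ann. of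
Math. 97 (1973), §5, applied to `Σ' = ⋃ xᵢ × S²`, then extension over the `0`-handle by `Γ₄ = 0`
and over the `1`-handles).  The slice is written out inside the statements (the body of THMAᴹ at
`p + 1`); no `def` is introduced for it.

* `exists_oneHandlebody_laudenbachPoenaru_diffeoExtends_of_isOrientationPreserving_of_cerf_of_succ`
  (§1): **THMAᴹ (universe `0`) from `Γ₄ = 0` and its positive-genus slice** — at `p = 0` the
  model is the closed ball `𝔻⁴ ⊂ ℝ⁴` with its handle decomposition `‖x‖²`
  (`hasHandleDecomposition_closedBall`), boundary datum `𝕊³ ↪ 𝔻⁴` (`closedBallBoundaryData 3`)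
  and base point `e₀`, on which *every* boundary diffeomorphism extends by
  `BoundaryData.diffeoExtends_of_handleCount_one_zero_of_cerf` (`SPC4HandlesThmAGenusZero.lean`).
* `laudenbachPoenaru_diffeoExtends_of_isOrientationPreserving_of_cerf_of_succ` (§2): hence h₂ in
  every universe (`laudenbachPoenaru_diffeoExtends_of_isOrientationPreserving_of_two_leaves` with
  the discharged L1, `oneHandle_nonempty_diffeomorph_holds`).
* `exists_diffeomorph_comp_incl_eq_of_realise_of_cerf_of_succ`,
  `exists_diffeomorph_comp_incl_eq_of_lemma2_of_cerf_of_succ` (§2): **the extension fact from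
  REALISE (resp. h₁), `Γ₄ = 0` and the positive-genus slice of THMAᴹ** — the exact residue of
  `exists_diffeomorph_comp_incl_eq` after Cerf's theorem.
* `thmA_succ_of_exists_diffeomorph_comp_incl_eq_zero` (§3): conversely the slice is contained in
  the fact (universe `0` suffices), so nothing stronger than the fact is being asked for.

## References

* F. Laudenbach, V. Poénaru, *A note on 4-dimensional handlebodies*, Bull. Soc. Math. France
  100 (1972), 337–344: §2, Lemma 2 (pp. 339–340), Lemma 3 (p. 340), proof of Thm. A
  (pp. 341–342).  Held: `lit read doi-10-24033-bsmf-1741`. [LaudenbachPoenaruBSMF1972]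
* F. Laudenbach, *Sur les 2-sphères d'une variété de dimension 3*, Ann. of Math. 97 (1973),
  57–81, §5. [Laudenbach1973]
* J. Cerf, *Sur les difféomorphismes de la sphère de dimension trois (Γ₄ = 0)*, Lecture Notes in
  Math. 53 (1968), Introduction and Ch. I §1, Théorème 1, Corollaire 1. [CerfDiffeoSphere1968]
* A. A. Kosinski, *Differential Manifolds* (1993), VI (6.6), (11.4)(c). [Kosinski1993]
* R. C. Kirby, *The topology of 4-manifolds*, LNM 1374 (1989), Ch. I §2, p. 8. [Kirby1989]

## Design notes

* Only theorems are added.  The sphere and the ball are written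
  `Metric.sphere (0 : EuclideanSpace ℝ (Fin 4)) 1`, `Metric.closedBall (0 : EuclideanSpace ℝ (Fin 4)) 1`
  (no notation), as in `SPC4HandlesThmAGenusZero.lean`.
* The positive-genus slice is stated at `p + 1` (rather than under `0 < p`) and in universe `0`,
  the universe in which THMAᴹ is consumed by `exists_diffeomorph_comp_incl_eq_of_two_leaves`.
-/

open scoped Manifold ContDiff Topology
open Set Function Metric

noncomputable section

namespace Literature.Topology.FourManifolds

universe u

/-! ### §1 THMAᴹ from `Γ₄ = 0` and its positive-genus slice -/

/-- **THMAᴹ in universe `0` from Cerf's `Γ₄ = 0` and the positive-genus slice of THMAᴹ.**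
If every self-diffeomorphism of `S³` extends over `D⁴`
(`cerf_diffeomorph_sphere_three_extends_ball`) and if for every `p` some compact connected
orientable smooth `4`-manifold with boundary with one `0`-handle and `p + 1` `1`-handles, some
boundary datum `b₀` and base point `z₀` have every orientation-preserving self-diffeomorphism of
`b₀.carrier` fixing `z₀` and inducing the identity of `π₁(b₀.carrier, z₀)` extend, then THMAᴹ
(`exists_oneHandlebody_laudenbachPoenaru_diffeoExtends_of_isOrientationPreserving`) holds in
universe `0`: at `p = 0` take `Y₀ = 𝔻⁴` (`hasHandleDecomposition_closedBall 3`,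
`isOrientable_closedBall 3`, boundary datum `closedBallBoundaryData 3`, base point `e₀ ∈ 𝕊³`),
on which every boundary diffeomorphism extends by
`BoundaryData.diffeoExtends_of_handleCount_one_zero_of_cerf` — the case `p = 0` of Thm. A *is*
`Γ₄ = 0` (`D⁴ ∪_h D⁴ ≅ S⁴` for every `h`). [cite: LaudenbachPoenaruBSMF1972, §2, proof of Thm. A, pp. 341–342]
[cite: CerfDiffeoSphere1968, Ch. I §1, Théorème 1 with Corollaire 1 (Γ₄ = 0)] -/
theorem exists_oneHandlebody_laudenbachPoenaru_diffeoExtends_of_isOrientationPreserving_of_cerf_of_succ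
    (hC : cerf_diffeomorph_sphere_three_extends_ball)
    (hpos : ∀ p : ℕ, ∃ (V₀ : Type) (_ : TopologicalSpace V₀) (_ : T2Space V₀)
      (_ : SecondCountableTopology V₀) (_ : CompactSpace V₀) (_ : ConnectedSpace V₀)
      (_ : ChartedSpace (EuclideanHalfSpace 4) V₀) (_ : IsManifold (𝓡∂ 4) ∞ V₀)
      (b₀ : BoundaryData (𝓡∂ 4) V₀ (𝓡 3)) (z₀ : b₀.carrier),
      HasHandleDecomposition 3 V₀ (handleCount 1 (p + 1)) ∧ IsOrientable (𝓡∂ 4) V₀ ∧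
      ∀ (ψ : b₀.carrier ≃ₘ⟮𝓡 3, 𝓡 3⟯ b₀.carrier),
        (∀ o : SmoothOrientation (𝓡 3) b₀.carrier, ψ.IsOrientationPreserving o o) →
        ∀ hz : ψ z₀ = z₀,
          (∀ a : FundamentalGroup b₀.carrier z₀,
            FundamentalGroup.mapOfEq (⟨ψ, ψ.continuous⟩ : C(b₀.carrier, b₀.carrier)) hz a = a) →
          b₀.DiffeoExtends ψ) :
    exists_oneHandlebody_laudenbachPoenaru_diffeoExtends_of_isOrientationPreserving.{0} := by
  intro p
  cases p with
  | succ p => exact hpos p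
  | zero =>
    haveI : Fact (isSmoothEmbedding_sphereInclusion' 3) :=
      ⟨isSmoothEmbedding_sphereInclusion'_holds 3⟩
    haveI : ConnectedSpace (Metric.closedBall (0 : EuclideanSpace ℝ (Fin 4)) 1) :=
      connectedSpace_closedBall 3
    -- the base point `e₀ = (1, 0, 0, 0) ∈ 𝕊³`
    have he₀ : EuclideanSpace.single (0 : Fin 4) (1 : ℝ) ∈
        Metric.sphere (0 : EuclideanSpace ℝ (Fin 4)) 1 := by
      simp
    refine ⟨Metric.closedBall (0 : EuclideanSpace ℝ (Fin 4)) 1, inferInstance, inferInstance,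
      inferInstance, inferInstance, inferInstance, inferInstance, inferInstance,
      closedBallBoundaryData 3, ⟨EuclideanSpace.single (0 : Fin 4) (1 : ℝ), he₀⟩,
      hasHandleDecomposition_closedBall 3, isOrientable_closedBall 3, ?_⟩
    intro ψ _ _ _
    exact BoundaryData.diffeoExtends_of_handleCount_one_zero_of_cerf hC
      (hasHandleDecomposition_closedBall 3) (isOrientable_closedBall 3) (closedBallBoundaryData 3) ψ

/-! ### §2 h₂ and the extension fact from REALISE / h₁, `Γ₄ = 0` and the positive-genus slice -/

/-- **h₂ in every universe from `Γ₄ = 0` and the positive-genus slice of THMAᴹ**: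
`laudenbachPoenaru_diffeoExtends_of_isOrientationPreserving_of_two_leaves`
(`SPC4HandlesThmALift.lean`, §4) with the discharged `1`-handle lemma
`oneHandle_nonempty_diffeomorph_holds` and §1. [cite: LaudenbachPoenaruBSMF1972, §2, proof of Thm. A, pp. 341–342]
[cite: CerfDiffeoSphere1968, Ch. I §1, Théorème 1 with Corollaire 1 (Γ₄ = 0)]
[cite: Kosinski1993, VI (6.6), (11.4)(c)] -/
theorem laudenbachPoenaru_diffeoExtends_of_isOrientationPreserving_of_cerf_of_succ
    (hC : cerf_diffeomorph_sphere_three_extends_ball)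
    (hpos : ∀ p : ℕ, ∃ (V₀ : Type) (_ : TopologicalSpace V₀) (_ : T2Space V₀)
      (_ : SecondCountableTopology V₀) (_ : CompactSpace V₀) (_ : ConnectedSpace V₀)
      (_ : ChartedSpace (EuclideanHalfSpace 4) V₀) (_ : IsManifold (𝓡∂ 4) ∞ V₀)
      (b₀ : BoundaryData (𝓡∂ 4) V₀ (𝓡 3)) (z₀ : b₀.carrier),
      HasHandleDecomposition 3 V₀ (handleCount 1 (p + 1)) ∧ IsOrientable (𝓡∂ 4) V₀ ∧
      ∀ (ψ : b₀.carrier ≃ₘ⟮𝓡 3, 𝓡 3⟯ b₀.carrier),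
        (∀ o : SmoothOrientation (𝓡 3) b₀.carrier, ψ.IsOrientationPreserving o o) →
        ∀ hz : ψ z₀ = z₀,
          (∀ a : FundamentalGroup b₀.carrier z₀,
            FundamentalGroup.mapOfEq (⟨ψ, ψ.continuous⟩ : C(b₀.carrier, b₀.carrier)) hz a = a) →
          b₀.DiffeoExtends ψ) :
    laudenbachPoenaru_diffeoExtends_of_isOrientationPreserving.{u} :=
  laudenbachPoenaru_diffeoExtends_of_isOrientationPreserving_of_two_leaves
    oneHandle_nonempty_diffeomorph_holds
    (exists_oneHandlebody_laudenbachPoenaru_diffeoExtends_of_isOrientationPreserving_of_cerf_of_succ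
      hC hpos)

/-- **Laudenbach–Poénaru's extension theorem from REALISE, `Γ₄ = 0` and the positive-genus slice
of THMAᴹ** — the residue of `exists_diffeomorph_comp_incl_eq` once Cerf's theorem is granted:
`exists_diffeomorph_comp_incl_eq_of_two_leaves` (`SPC4HandlesTwoLeaves.lean`) with §1.  The
discharge `exists_diffeomorph_comp_incl_eq_holds` is this theorem applied to proofs of the
realisation of `H₁, H₂, H₃` on the model (Lemma 2, pp. 339–340), of `Γ₄ = 0`
(`cerf_diffeomorph_sphere_three_extends_ball`) and of Thm. A on `Y_p`, `p ≥ 1` (p. 342: Lemma 3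
and Laudenbach (1973), §5), once those land.
[cite: LaudenbachPoenaruBSMF1972, §2, Lemma 2 and proof of Thm. A (pp. 339–342)]
[cite: CerfDiffeoSphere1968, Ch. I §1, Théorème 1 with Corollaire 1 (Γ₄ = 0)] -/
theorem exists_diffeomorph_comp_incl_eq_of_realise_of_cerf_of_succ
    (hR : exists_oneHandlebody_realise_laudenbachPoenaruGenerators.{u})
    (hC : cerf_diffeomorph_sphere_three_extends_ball)
    (hpos : ∀ p : ℕ, ∃ (V₀ : Type) (_ : TopologicalSpace V₀) (_ : T2Space V₀)
      (_ : SecondCountableTopology V₀) (_ : CompactSpace V₀) (_ : ConnectedSpace V₀)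
      (_ : ChartedSpace (EuclideanHalfSpace 4) V₀) (_ : IsManifold (𝓡∂ 4) ∞ V₀)
      (b₀ : BoundaryData (𝓡∂ 4) V₀ (𝓡 3)) (z₀ : b₀.carrier),
      HasHandleDecomposition 3 V₀ (handleCount 1 (p + 1)) ∧ IsOrientable (𝓡∂ 4) V₀ ∧
      ∀ (ψ : b₀.carrier ≃ₘ⟮𝓡 3, 𝓡 3⟯ b₀.carrier),
        (∀ o : SmoothOrientation (𝓡 3) b₀.carrier, ψ.IsOrientationPreserving o o) →
        ∀ hz : ψ z₀ = z₀,
          (∀ a : FundamentalGroup b₀.carrier z₀,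
            FundamentalGroup.mapOfEq (⟨ψ, ψ.continuous⟩ : C(b₀.carrier, b₀.carrier)) hz a = a) →
          b₀.DiffeoExtends ψ) :
    exists_diffeomorph_comp_incl_eq.{u} :=
  exists_diffeomorph_comp_incl_eq_of_two_leaves hR
    (exists_oneHandlebody_laudenbachPoenaru_diffeoExtends_of_isOrientationPreserving_of_cerf_of_succ
      hC hpos)

/-- **The same with Lemma 2 in its abstract form h₁** (`laudenbachPoenaru_exists_diffeoExtends_mapOfEq_eq`,
which the tree reduces model-free to handle slides on every decomposed `1`-handlebody,
`laudenbachPoenaru_exists_diffeoExtends_mapOfEq_eq_of_forall_realise_nielsen`,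
`SPC4HandlesLemma2Direct.lean`): `exists_diffeomorph_comp_incl_eq_of_lemma2_of_thmA`
(`SPC4HandlesTwoLeaves.lean`) with §2. [cite: LaudenbachPoenaruBSMF1972, §2, Lemma 2 and proof of Thm. A (pp. 339–342)]
[cite: CerfDiffeoSphere1968, Ch. I §1, Théorème 1 with Corollaire 1 (Γ₄ = 0)] -/
theorem exists_diffeomorph_comp_incl_eq_of_lemma2_of_cerf_of_succ
    (h₁ : laudenbachPoenaru_exists_diffeoExtends_mapOfEq_eq.{u})
    (hC : cerf_diffeomorph_sphere_three_extends_ball)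
    (hpos : ∀ p : ℕ, ∃ (V₀ : Type) (_ : TopologicalSpace V₀) (_ : T2Space V₀)
      (_ : SecondCountableTopology V₀) (_ : CompactSpace V₀) (_ : ConnectedSpace V₀)
      (_ : ChartedSpace (EuclideanHalfSpace 4) V₀) (_ : IsManifold (𝓡∂ 4) ∞ V₀)
      (b₀ : BoundaryData (𝓡∂ 4) V₀ (𝓡 3)) (z₀ : b₀.carrier),
      HasHandleDecomposition 3 V₀ (handleCount 1 (p + 1)) ∧ IsOrientable (𝓡∂ 4) V₀ ∧
      ∀ (ψ : b₀.carrier ≃ₘ⟮𝓡 3, 𝓡 3⟯ b₀.carrier),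
        (∀ o : SmoothOrientation (𝓡 3) b₀.carrier, ψ.IsOrientationPreserving o o) →
        ∀ hz : ψ z₀ = z₀,
          (∀ a : FundamentalGroup b₀.carrier z₀,
            FundamentalGroup.mapOfEq (⟨ψ, ψ.continuous⟩ : C(b₀.carrier, b₀.carrier)) hz a = a) →
          b₀.DiffeoExtends ψ) :
    exists_diffeomorph_comp_incl_eq.{u} :=
  exists_diffeomorph_comp_incl_eq_of_lemma2_of_thmA h₁
    (laudenbachPoenaru_diffeoExtends_of_isOrientationPreserving_of_cerf_of_succ hC hpos)

/-! ### §3 Conversely: the positive-genus slice is contained in the fact -/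

/-- **The positive-genus slice of THMAᴹ (any universe) from the extension fact in universe `0`**:
drop `p = 0` from
`exists_oneHandlebody_laudenbachPoenaru_diffeoExtends_of_isOrientationPreserving_of_exists_diffeomorph_comp_incl_eq_zero`
(`SPC4HandlesTwoLeaves.lean`).  Together with
`cerf_diffeomorph_sphere_three_extends_ball_of_exists_diffeomorph_comp_incl_eq`
(`SPC4HandlesImpliesCerf.lean`) and §2: in universe `0` the fact is *equivalent* to
h₁-or-REALISE ∧ `Γ₄ = 0` ∧ (THMAᴹ, `p ≥ 1`) — granted Lemma 2, exactly Cerf's theorem plus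
Laudenbach–Poénaru's positive-genus argument. [cite: LaudenbachPoenaruBSMF1972, §2, proof of Thm. A, p. 342] -/
theorem thmA_succ_of_exists_diffeomorph_comp_incl_eq_zero
    (h : exists_diffeomorph_comp_incl_eq.{0}) (p : ℕ) :
    ∃ (V₀ : Type u) (_ : TopologicalSpace V₀) (_ : T2Space V₀)
      (_ : SecondCountableTopology V₀) (_ : CompactSpace V₀) (_ : ConnectedSpace V₀)
      (_ : ChartedSpace (EuclideanHalfSpace 4) V₀) (_ : IsManifold (𝓡∂ 4) ∞ V₀)
      (b₀ : BoundaryData (𝓡∂ 4) V₀ (𝓡 3)) (z₀ : b₀.carrier),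
      HasHandleDecomposition 3 V₀ (handleCount 1 (p + 1)) ∧ IsOrientable (𝓡∂ 4) V₀ ∧
      ∀ (ψ : b₀.carrier ≃ₘ⟮𝓡 3, 𝓡 3⟯ b₀.carrier),
        (∀ o : SmoothOrientation (𝓡 3) b₀.carrier, ψ.IsOrientationPreserving o o) →
        ∀ hz : ψ z₀ = z₀,
          (∀ a : FundamentalGroup b₀.carrier z₀,
            FundamentalGroup.mapOfEq (⟨ψ, ψ.continuous⟩ : C(b₀.carrier, b₀.carrier)) hz a = a) →
          b₀.DiffeoExtends ψ :=
  exists_oneHandlebody_laudenbachPoenaru_diffeoExtends_of_isOrientationPreserving_of_exists_diffeomorph_comp_incl_eq_zero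
    h (p + 1)

/-- **The fact in universe `0` is equivalent to: REALISE, `Γ₄ = 0` and the positive-genus slice of
THMAᴹ, granted REALISE** (the two directions of §§2–3 and `SPC4HandlesImpliesCerf.lean`).
[cite: LaudenbachPoenaruBSMF1972, §2, Lemma 2 and proof of Thm. A (pp. 339–342)]
[cite: CerfDiffeoSphere1968, Ch. I §1, Théorème 1 with Corollaire 1 (Γ₄ = 0)] -/
theorem exists_diffeomorph_comp_incl_eq_zero_iff_cerf_and_succ_of_realise
    (hR : exists_oneHandlebody_realise_laudenbachPoenaruGenerators.{0}) :
    exists_diffeomorph_comp_incl_eq.{0} ↔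
      cerf_diffeomorph_sphere_three_extends_ball ∧
      ∀ p : ℕ, ∃ (V₀ : Type) (_ : TopologicalSpace V₀) (_ : T2Space V₀)
        (_ : SecondCountableTopology V₀) (_ : CompactSpace V₀) (_ : ConnectedSpace V₀)
        (_ : ChartedSpace (EuclideanHalfSpace 4) V₀) (_ : IsManifold (𝓡∂ 4) ∞ V₀)
        (b₀ : BoundaryData (𝓡∂ 4) V₀ (𝓡 3)) (z₀ : b₀.carrier),
        HasHandleDecomposition 3 V₀ (handleCount 1 (p + 1)) ∧ IsOrientable (𝓡∂ 4) V₀ ∧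
        ∀ (ψ : b₀.carrier ≃ₘ⟮𝓡 3, 𝓡 3⟯ b₀.carrier),
          (∀ o : SmoothOrientation (𝓡 3) b₀.carrier, ψ.IsOrientationPreserving o o) →
          ∀ hz : ψ z₀ = z₀,
            (∀ a : FundamentalGroup b₀.carrier z₀,
              FundamentalGroup.mapOfEq (⟨ψ, ψ.continuous⟩ : C(b₀.carrier, b₀.carrier)) hz a = a) →
            b₀.DiffeoExtends ψ :=
  ⟨fun h => ⟨cerf_diffeomorph_sphere_three_extends_ball_of_exists_diffeomorph_comp_incl_eq h,
      thmA_succ_of_exists_diffeomorph_comp_incl_eq_zero h⟩,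
    fun h => exists_diffeomorph_comp_incl_eq_of_realise_of_cerf_of_succ hR h.1 h.2⟩

end Literature.Topology.FourManifolds

end
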